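import Summits.HodgeConjecture.HodgeConjecture.Theorems.F0P3LettersRouting                 -- ★ p823358: the LETTER #82 `CohClassRouting` (+ cone: `clFinChoice`, `admUnitConstituents`, V6 kit frame `Gp`, `IsCot`, `HasToken`, D6 `MemXiFamily`)
import Summits.HodgeConjecture.HodgeConjecture.Theorems.F0P3RamClsOfRecordAntihol            -- ★ K2-cot: `eventually_exists_spherical_mem_admUnitConstituents_of_isAntiholCotangentAt` (+ ★ hol `F0P3RamClsOfRecord.eventually_exists_spherical_mem_admUnitConstituents`)
import Summits.HodgeConjecture.HodgeConjecture.Theorems.F0P3LocalClassRouting                -- ★ p826873 (F0P3-p03 (g7), lifted from typ-T2b's draft): THE LOCAL GLUE `localRouting_of_memXiFamily` (uses ★ K3 p826064∕p826158, ★ K5 p825897∕p826024, ★ p825600∕p825780, letter SqNS)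
import Literature.NumberTheory.Rogawski1990.GlobalAPacketLetters                             -- ★ #70 S2♭ `Literature.NumberTheory.Rogawski1990.cohDiscrete_memXiFamily` (the GLOBAL node, LETTER)
import Summits.HodgeConjecture.HodgeConjecture.Theorems.F0P3CohClassRoutingCot               -- ★ p830755 (R-32 LIFT, RULING (V61), ED. 6): `RoutesAt` ∕ `CohClassRoutingCot` ∕ `CohClassRoutingCotClosed` ∕ `cohClassRoutingCot_of_cohClassRouting` — the §0∕§4 texts of ED. ≤ 5, now a ★ THEOREMS module shared with the K9β closer
import Summits.HodgeConjecture.HodgeConjecture.Theorems.F0P3SqNSNonsplitConsumers           -- ★ p833675 (A-p03 (g22), ED. 7): `localRouting_of_memXiFamily_of_nonsplit` — the local glue re-threaded to the NON-SPLIT form (SqNS♭)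
import Summits.HodgeConjecture.HodgeConjecture.Theorems.F0P3SqIntNotSphericalNonsplitCofinite -- ★ p833536 (B-p08 (g23), road (B) closer, ED. 7): `squareIntegrableNotSpherical_nonsplit_cofinite (L)` — (SqNS♭) as a THEOREM, hypothesis-free
import HarnessLib

/-!
# LINE «CohClassRouting» PAY-DOWN, GUARDED HEAD (typer∕survey topic T2, seat a — ED. 6 = ED. 5 with §0∕§4 DEFINITIONS LIFTED to ★ `Theorems/F0P3CohClassRoutingCot.lean` (R-32); director g16 PLAN-THROUGHPUT §4 row T2, s573)

EDITION 7 (2026-08-31, A-p03 (g22) pen on F0P3-plan (g7)'s PEN ORDER 20:28:11Z; director s684 (2)): THE LETTER (SqNS) IS PAID.  Road (B) «local» made the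
NON-SPLIT content of letter #90 `Rogawski1990.SquareIntegrableNotSphericalCofinite` a THEOREM of the tree, hypothesis-free — ★ `F0P3SqIntNotSphericalNonsplitCofinite.
squareIntegrableNotSpherical_nonsplit_cofinite (L)` (B-p08 (g23) p833536, over A-p03 (g22) ★ p832624 (L2-gen) · p833008 (L1: the hyperspecial Hecke neighbours of `U(3)`,
Bruhat–Tits (4.4.4)) · p833380 (L1b: the hyperspecial vertex of the `(q³+1, q+1)`-tree carries no `L²` spherical function, Macdonald Ch. V) and B-p08 ★ p832978 · p833425
(transport to `Gqs L v`)) — and the only two uses of `hSq` in the glue sit under the non-split guard (★ `F0P3SqNSNonsplitConsumers.localRouting_of_memXiFamily_of_nonsplit`,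
A-p03 (g22) p833675: SAME conclusion as ★ p826873 with `hSq` weakened to (SqNS♭)).  Hence: `stub_SqNS` is DELETED (its all-places statement is not what closed — the
non-split form is, and no consumer ever read the split clause; same treatment as `hquad` at the closer's ED. 6); `localRouting` (§1b) loses the binder `hSq` and calls the
re-threaded glue on the ★ theorem; `cohClassRoutingCot_holds` drops `(stub_SqNS L)`.  Heads `cohClassRoutingCot_holds` ∕ `cohClassRoutingCot_closed` statements BYTE-IDENTICAL;
`stub_S2`, `cotSpherical`, `cohClassRoutingCot_of_stubs` byte-identical.  Registered stubs 2 → 1 = {`stub_S2`} (#70 S2♭, GLOBAL, RUNG 5); axioms of the head = TRIO ⧺ sorryAx(`stub_S2`).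

EDITION 6 (2026-08-31, F0P3-p04 (g8) pen on F0P3-plan (g6)'s HANDOFF §2; RULING (V61) R-32 LIFT): the three Prop-valued definitions `RoutesAt`, `CohClassRoutingCot`,
`CohClassRoutingCotClosed` and the sanity lemma `cohClassRoutingCot_of_cohClassRouting` are NO LONGER declared here — they live, token for token (REF1 kernel-identity box
17:56:08Z: `Iff.rfl`∕`rfl` at full telescopes), in the ★ THEOREMS module `Theorems/F0P3CohClassRoutingCot.lean` (p830755, namespace `…Cruxes.H413.F0P3CohClassRoutingCot`), which
this file now imports and `open`s; every remaining declaration (`stub_S2`, `stub_SqNS`, `localRouting`, `cotSpherical`, `cohClassRoutingCot_of_stubs`, `cohClassRoutingCot_holds`,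
`cohClassRoutingCot_closed`) is BYTE-UNCHANGED and elaborates against the lifted names; the head `cohClassRoutingCot_closed : CohClassRoutingCotClosed` now denotes
`F0P3CohClassRoutingCot.CohClassRoutingCotClosed` — the SAME constant the rung-0 closer's `stub_L3` is typed on from its ED. 8 (so the day this head is sorry-free the junction
`stub_L3 := F0T2CohClassRoutingCotPaydown.cohClassRoutingCot_closed` type-checks with no Lines import on either side).  Registered stubs unchanged (2: `stub_S2`, `stub_SqNS`).

Cell `hodgecm-mathlib`, F0∕P3 «U3-mult», crux H413 (`stmt-HodgeConjecture-24833`), letter (L3′) #82 `CohClassRouting` [Rogawski1990 §15.3 ¶1 p. 244; Thm. 13.3.6 (c) p. 202;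
§13.1 p. 199; §12.2 (2) pp. 173–174; §14.2 pp. 232–234] (★ p823358, CITED, k = 1; consumer ★ `routing_kitOfRecord` → kit law #15 `Routing` → K9β `stub_L3`).
HONEST LABEL: HC_CM is proved only modulo the printed citations («named inputs remaining 2») until rung 0 closes; this line discharges NOTHING by itself: its head holds
modulo EXACTLY the two cited letters `stub_S2` (= #70 S2♭, GLOBAL, RUNG 5) and `stub_SqNS` — the row #82 closes BY NAME into {#70, SqNS}, both existing rows, 0 new letters.
Drafted in HOME `F0/P3/Lines-draft/T2a_CohClassRoutingCotPaydown.lean` (typ-T2a (g0)); tree target (T2 desk 15:15:14Z (e)) `Cruxes/H413/Lines/F0_T2_CohClassRoutingCotPaydown.lean`;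
the desk∕pen registers it.  Map: `F0/P3/T2a-TREE.md` (§1 DAG, §3 findings F1–F4), twin `F0/P3/T2b-TREE.md`; file of record WITH the in-file glue proof, the compact-centre
theorem and the UNGUARDED variant §3b: `F0/P3/Lines-draft/T2a_CohClassRoutingCotPaydown.v4.sidecar.lean` (38850785fafae3d1).

THE HEAD is the letter GUARDED BY COTANGENT TYPE, `CohClassRoutingCot … := ∀ P, IsCot L H ι T hT μ P → ‹body of CohClassRouting at P›` (§0; = typ-T2b's unguarded draft + the
director's D2 fold).  Reason (finding F3): the letter is unguarded in `P`, but node K2 («`P_v = P_v⁰` for almost all `v`»: a `K_v^H`-spherical admissible unitarizable constituent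
cofinitely) is ★ IN-HOUSE exactly for cotangent-type `P` (hol: ★ `eventually_exists_spherical_mem_admUnitConstituents`; antihol: ★ `…_of_isAntiholCotangentAt`), and the kit law
`Routing` (★ V7∕V8 :183) is ITSELF guarded `IsCot P → KcTrivial P → …`.  CONSUMER JUNCTION (read in the tree): ★ `routing_kitOfRecord` and the ★ V8 family assembler's conjunct #15
take the UNGUARDED v6 text, so feeding THIS head to the closer needs the per-`P` re-thread `CohClassRoutingCot → V8 `Routing` (kitOfRecord …)` (★ `laws₈_kitOfRecord_of₄` already takes
`h15` guarded) — a prover's `Theorems/` text, kernel-checked in the sidecar `Lines-draft/T2a_RoutingKitOfRecordOfCot.sidecar.lean`; F0P3-plan rules guarded vs unguarded (+1 AFA-type row).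
FRAME (findings F1∕F2): the letters' frame `hdef h2 hμω` of S2♭ (print's `μ|_{C_F} = ω_{E/F}`, §4.8 p. 51) and the rung-0 instances `[BorelSpace (Gqs L v ⧸ Z)]`,
`[(μZ v).IsHaarMeasure]` at THE LINE's `μZ` (both inside `stub_rung0`'s ∃ of the K9β closer) — i.e. the CLOSER's frame, not `CohClassRouting`'s bare binders; `hquad`∕XP (#79) are
NOT used.  K9β's `StubL3` must be RE-CUT to `CohClassRoutingCotClosed` (§4) token for token (T2 desk JUNCTION FLAG).

THE CUT (ED. 5: EXACTLY 2 stubs = the 2 letters of record; everything else ★ BY NAME or proved here):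
* `stub_S2` (LETTER, GLOBAL, P7 — ★-typed #70 BY NAME) — `Literature.NumberTheory.Rogawski1990.cohDiscrete_memXiFamily`: token ⇒ `∃ ξ, MemXiFamily P … ξ` [Thm. 14.6.4; 13.3.6 (c); §15.3 ¶1; 15.2.1 (b)].
* (ED. ≤ 6: `stub_SqNS` (LETTER) — `∀ L, Literature.NumberTheory.Rogawski1990.SquareIntegrableNotSphericalCofinite L` [Macdonald1971 V; Casselman1980 §4]; DELETED at ED. 7: its
  non-split form (SqNS♭) is ★ `F0P3SqIntNotSphericalNonsplitCofinite.squareIntegrableNotSpherical_nonsplit_cofinite`, hypothesis-free, and is what the glue consumes.)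
* THE LOCAL GLUE — ★ BY NAME (`localRouting` := ★ p826873 `F0P3LocalClassRouting.localRouting_of_memXiFamily`, F0P3-p03 (g7) from typ-T2b's draft; = this seat's v3∕v4 in-file
  `nonsplitRouting` + `localRouting_split` + `localRouting`, kept in the sidecar): from `MemXiFamily P … ξ`, a cofinite spherical admissible-unitarizable constituent and (SqNS) to the
  class routing off a finite set — split `v` ⇒ the D6 singleton; non-split `v` ⇒ `⟨x ∘ e₀⁻¹, s⟩`, `s` excluded by ★ K3 (typ-T2a p826158) at the compact centre (★ p825600∕p825780),
  `x = π²` by (SqNS) at Keys' `L²` label, congruence independence by ★ K5 (typ-T2b p825897 + p826024) [§13.1 p. 199, Prop. 13.1.3 (d); §12.2 (2); §14.2 pp. 232–234].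
* junction `cotSpherical` (no `sorry`) — K2 for cotangent-type `P` from the two ★ theorems.
* compositions `cohClassRoutingCot_of_stubs` ∕ `cohClassRoutingCot_holds` (§3) and the registered closed form `CohClassRoutingCotClosed` ∕ `cohClassRoutingCot_closed` (§4).

DEF∕PROOF discipline: `sorry` ONLY inside the two `stub_*`; NO `def` in this file since ED. 6 (the three Prop-valued texts `RoutesAt`, the guarded letter and the closed registered form are ★ `Theorems/F0P3CohClassRoutingCot.lean`);
no instance declaration (one LOCAL instance attribute, the ★ `F0P3LettersRouting` idiom needed to MENTION `→ₗ⁅ℝ⁆ Module.End ℂ M`), no notation; `--supports stmt-HodgeConjecture-24833`.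
-/

set_option autoImplicit false
set_option linter.dupNamespace false

noncomputable section

open NumberField IsDedekindDomain MeasureTheory Filter
open Literature.NumberTheory.Rogawski1990 Literature.NumberTheory.GaloisRepresentations
open Literature.NumberTheory.Automorphic Literature.NumberTheory.Automorphic.UnitaryGroup
open Literature.NumberTheory.Automorphic.UnitaryGroup.CotangentForms
open Literature.RepresentationTheory.BorelWallach2000 Literature.RepresentationTheory.KonnoKonno2007
open scoped Matrix Classical ComplexOrder

namespace Summit.HodgeConjecture.HodgeConjecture.Cruxes.H413.F0T2CohClassRoutingCotPaydown

open Summit.HodgeConjecture.HodgeConjecture.Cruxes.H413.F0P3InnerFormClassificationV6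
open Summit.HodgeConjecture.HodgeConjecture.Cruxes.H413.F0P3ClassTokenChoice (clFinChoice admUnitConstituents)
open Summit.HodgeConjecture.HodgeConjecture.Cruxes.H413.F0P3LettersRouting (CohClassRouting)
open Summit.HodgeConjecture.HodgeConjecture.Cruxes.H413.F0P3CohClassRoutingCot (RoutesAt CohClassRoutingCot CohClassRoutingCotClosed cohClassRoutingCot_of_cohClassRouting)  -- ★ p830755 (ED. 6, R-32)

-- Mathlib idiom (as in ★ `F0P3LettersRouting`): commutator bracket on `Module.End`, needed to MENTION `(uFormGroup (Fin 2) (Fin 1)).lie →ₗ⁅ℝ⁆ Module.End ℂ M`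
attribute [local instance 100] LieRing.ofAssociativeRing

variable (L : Type) [Field L] [NumberField L] [IsCMField L] (H : Matrix (Fin 3) (Fin 3) L)
  (hH : (H.map (cmConjRingHom L))ᵀ = H) (hHd : IsUnit H.det) (μω : HeckeCharacter L) (hμu : μω.IsUnitary)
  [∀ v : HeightOneSpectrum (𝓞 ↥(maximalRealSubfield L)), MeasurableSpace (Gqs L v ⧸ Subgroup.center (Gqs L v))]
  (μZ : ∀ v : HeightOneSpectrum (𝓞 ↥(maximalRealSubfield L)), Measure (Gqs L v ⧸ Subgroup.center (Gqs L v)))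
  (keys : ∀ (ξ : OneDimAutRepH L) (v : HeightOneSpectrum (𝓞 ↥(maximalRealSubfield L))),
    (∀ w : PlacesOver L v, IsCMField.complexConj L • w.1 = w.1) →
      {p : IrrClass (Gqs L v) × IrrClass (Gqs L v) //
        KeysCaseTwoLabels L v (μω.semilocalComponent L v) (torusLocalComponent L (IsCMField.complexConj L) v ξ.η)
          (torusLocalComponent L (IsCMField.complexConj L) v ξ.ψ) p.1 p.2 ∧
        p.1.IsSquareIntegrable (μZ v) ∧ ¬ p.2.IsSquareIntegrable (μZ v)})
  (ι : L →+* ℂ) (T : GL (Fin 3) ℂ)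
  (hT : (T : Matrix (Fin 3) (Fin 3) ℂ)ᴴ * H.map ι * (T : Matrix (Fin 3) (Fin 3) ℂ) = Literature.Geometry.ComplexHyperbolic.BallModel.J)
  (μ : Measure (Gp L H).automorphicQuotient) [(Gp L H).IsAutomorphicMeasure μ]

/-! ## §0 The routing conclusion `RoutesAt` and the GUARDED letter `CohClassRoutingCot` — LIFTED (ED. 6, R-32) to ★ `Theorems/F0P3CohClassRoutingCot.lean` (p830755), `open`ed above -/

/-! ## §1 The two stubs = the two LETTERS of record (read BY NAME) -/

/-- **STUB (GLOBAL LETTER, ★-typed #70 BY NAME) — S2♭**: an `H¹`-cohomological discrete `P` lies in the ξ-local family of some one-dimensional automorphic `ξ`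
(RUNG 5: the twisted comparison of Ch. 10–13 + §14.6; P7). [cite: Rogawski1990, §14.6 Thm. 14.6.4; Thm. 13.3.6 (c) p. 202; §15.3 ¶1; Prop. 15.2.1 (b)] -/
theorem stub_S2 : Literature.NumberTheory.Rogawski1990.cohDiscrete_memXiFamily := by
  sorry

/-! ## §1b THE LOCAL GLUE — ★ BY NAME (p826873) -/

/-- **THE LOCAL GLUE (no `sorry`, NO LETTER — ED. 7)**: from `MemXiFamily P … ξ` and a cofinite `K_v^H`-spherical admissible unitarizable constituent, off a finite `S₁`
the routing conclusion `RoutesAt P ξ v` holds — ★ `F0P3SqNSNonsplitConsumers.localRouting_of_memXiFamily_of_nonsplit` (p833675; = ★ p826873 re-threaded: its two clauses ARE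
`RoutesAt`'s, token for token; the compact centre at a non-split `v` and ★ K3∕K5 are discharged inside it) FED THE ★ THEOREM (SqNS♭)
`F0P3SqIntNotSphericalNonsplitCofinite.squareIntegrableNotSpherical_nonsplit_cofinite L` (p833536: at cofinitely many NON-SPLIT `v` no square-integrable class of `U(Φ₃)(L⁺_v)` is
`U(Φ₃)(𝒪_v)`-spherical — the hyperspecial vertex of the Bruhat–Tits tree of `U(3)` carries no `L²` spherical function).
[cite: Rogawski1990, §13.1 p. 199; §12.2 (2) p. 174; §14.2 pp. 233–234; §13.3 p. 201] [cite: Macdonald1971, Ch. V §3] [cite: BruhatTits1972, (4.4.4)] -/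
theorem localRouting [∀ v : HeightOneSpectrum (𝓞 ↥(maximalRealSubfield L)), BorelSpace (Gqs L v ⧸ Subgroup.center (Gqs L v))]
    [∀ v : HeightOneSpectrum (𝓞 ↥(maximalRealSubfield L)), (μZ v).IsHaarMeasure]
    (P : DiscreteAutomorphicRep (Gp L H) μ) (ξ : OneDimAutRepH L) (hmem : MemXiFamily P hH hHd μω hμu ξ)
    (hsph : ∀ᶠ v : HeightOneSpectrum (𝓞 ↥(maximalRealSubfield L)) in cofinite,
      ∃ c ∈ admUnitConstituents P v, c.IsSpherical (cmLocalIntegralLevel L 3 H v)) :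
    ∃ S₁ : Finset (Places L), ∀ v : Places L, v ∉ S₁ → RoutesAt L H hH hHd μω hμu μZ keys μ P ξ v := by
  obtain ⟨S₁, hS⟩ := F0P3SqNSNonsplitConsumers.localRouting_of_memXiFamily_of_nonsplit L H
    (F0P3SqIntNotSphericalNonsplitCofinite.squareIntegrableNotSpherical_nonsplit_cofinite L) hH hHd μ μω hμu μZ keys P ξ hmem hsph
  exact ⟨S₁, fun v hv => hS v hv⟩

/-! ## §2 Junction (no `sorry`): K2 for cotangent-type `P` from the two ★ theorems -/

omit [∀ v : HeightOneSpectrum (𝓞 ↥(maximalRealSubfield L)), MeasurableSpace (Gqs L v ⧸ Subgroup.center (Gqs L v))] in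
/-- **K2 at cotangent type** — a holomorphic- or antiholomorphic-cotangent discrete `P` (compact CM datum: `hdef`, `h2`) has, at all but finitely many finite places, an admissible
unitarizable `K_v^H`-SPHERICAL constituent (★ hol `F0P3RamClsOfRecord.eventually_exists_spherical_mem_admUnitConstituents`, ★ antihol
`F0P3RamClsOfRecordAntihol.eventually_exists_spherical_mem_admUnitConstituents_of_isAntiholCotangentAt`). [cite: FlathCorvallis1979, Thm. 3] [cite: Rogawski1990, §13.3 p. 201; §14.5] -/
theorem cotSpherical (hdef : ∀ τ' : L →+* ℂ, InfinitePlace.mk τ' ≠ InfinitePlace.mk ι → (H.map τ').PosDef) (h2 : 2 ≤ Module.finrank ℚ ↥(maximalRealSubfield L))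
    (P : DiscreteAutomorphicRep (Gp L H) μ) (hP : IsCot L H ι T hT μ P) :
    ∀ᶠ v : HeightOneSpectrum (𝓞 ↥(maximalRealSubfield L)) in cofinite, ∃ c ∈ admUnitConstituents P v, c.IsSpherical (cmLocalIntegralLevel L 3 H v) := by
  obtain hP | hP := (hP : P.IsHolCotangentAt (cmArchSection L ι H T hT) (cmCompactFactor L ι H T hT) ∨
      P.IsAntiholCotangentAt (cmArchSection L ι H T hT) (cmCompactFactor L ι H T hT))
  · exact F0P3RamClsOfRecord.eventually_exists_spherical_mem_admUnitConstituents ι T hT hdef h2 P hP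
  · exact F0P3RamClsOfRecordAntihol.eventually_exists_spherical_mem_admUnitConstituents_of_isAntiholCotangentAt ι T hT hdef h2 P hP

/-! ## §3 The kernel-checked composition: the stub TEXTS imply the GUARDED letter, at the closer's frame -/

/-- **`CohClassRoutingCot` FROM THE STUBS** (composition, no `sorry`): the token gives `ξ` with `MemXiFamily P … ξ` (S2♭ at the letters' frame `hdef h2 hμω`; ★ `HasToken` IS S2♭'s
`∃ T₁` clause), cotangent type gives the cofinite spherical constituent (§2), and the local glue routes ((SqNS) and the compact centre enter only through the glue `hloc`, see
`cohClassRoutingCot_holds`). [cite: Rogawski1990, §15.3 ¶1; Thm. 13.3.6 (c); §13.1 p. 199; §12.2 (2)] -/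
theorem cohClassRoutingCot_of_stubs [∀ v : HeightOneSpectrum (𝓞 ↥(maximalRealSubfield L)), BorelSpace (Gqs L v ⧸ Subgroup.center (Gqs L v))]
    [∀ v : HeightOneSpectrum (𝓞 ↥(maximalRealSubfield L)), (μZ v).IsHaarMeasure]
    (hdef : ∀ τ' : L →+* ℂ, InfinitePlace.mk τ' ≠ InfinitePlace.mk ι → (H.map τ').PosDef) (h2 : 2 ≤ Module.finrank ℚ ↥(maximalRealSubfield L))
    (hμω : ∀ x : Literature.NumberTheory.GaloisRepresentations.ideleGroup ↥(maximalRealSubfield L), μω (AdeleRing.ideleBaseChange (↥(maximalRealSubfield L)) L x) = quadraticHeckeCharCM L x)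
    (hS2 : Literature.NumberTheory.Rogawski1990.cohDiscrete_memXiFamily)
    (hloc : ∀ (P : DiscreteAutomorphicRep (Gp L H) μ) (ξ : OneDimAutRepH L), MemXiFamily P hH hHd μω hμu ξ →
      (∀ᶠ v : HeightOneSpectrum (𝓞 ↥(maximalRealSubfield L)) in cofinite, ∃ c ∈ admUnitConstituents P v, c.IsSpherical (cmLocalIntegralLevel L 3 H v)) →
        ∃ S₁ : Finset (Places L), ∀ v : Places L, v ∉ S₁ → RoutesAt L H hH hHd μω hμu μZ keys μ P ξ v) :
    CohClassRoutingCot L H hH hHd μω hμu μZ keys ι T hT μ := by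
  intro P hP M _ _ σK σ𝔤 hM hirr htok δ hδ hne
  obtain ⟨ξ, hmem⟩ := hS2 L ι H T hT hdef h2 μ μω hμu hμω P M σK σ𝔤 hM hirr htok δ hδ hne
  exact ⟨ξ, hloc P ξ hmem (cotSpherical L H ι T hT μ hdef h2 P hP)⟩

/-- **The guarded letter at the stubs of THIS file** — modulo EXACTLY `stub_S2` (ED. 7: `stub_SqNS` is gone, paid by road (B); the local glue is ★ BY NAME, §1b).
[cite: Rogawski1990, §15.3 ¶1; Thm. 13.3.6 (c) p. 202] -/
theorem cohClassRoutingCot_holds [∀ v : HeightOneSpectrum (𝓞 ↥(maximalRealSubfield L)), BorelSpace (Gqs L v ⧸ Subgroup.center (Gqs L v))]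
    [∀ v : HeightOneSpectrum (𝓞 ↥(maximalRealSubfield L)), (μZ v).IsHaarMeasure]
    (hdef : ∀ τ' : L →+* ℂ, InfinitePlace.mk τ' ≠ InfinitePlace.mk ι → (H.map τ').PosDef) (h2 : 2 ≤ Module.finrank ℚ ↥(maximalRealSubfield L))
    (hμω : ∀ x : Literature.NumberTheory.GaloisRepresentations.ideleGroup ↥(maximalRealSubfield L), μω (AdeleRing.ideleBaseChange (↥(maximalRealSubfield L)) L x) = quadraticHeckeCharCM L x) :
    CohClassRoutingCot L H hH hHd μω hμu μZ keys ι T hT μ :=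
  cohClassRoutingCot_of_stubs L H hH hHd μω hμu μZ keys ι T hT μ hdef h2 hμω stub_S2 (localRouting L H hH hHd μω hμu μZ keys μ)

/-! ## §4 The closed form for the registry: all CLOSER frames at once (the `def` is ★-lifted since ED. 6; the head stays here) -/

-- `CohClassRoutingCotClosed` (the ∀-closure over all closer frames) is ★ `F0P3CohClassRoutingCot.CohClassRoutingCotClosed` since ED. 6 (R-32 lift, p830755).

/-- **REGISTERED-STYLE HEAD**: the closed guarded letter at the one stub of this file (`stub_S2`; ED. ≤ 6 also `stub_SqNS`) — `sorry`-free itself; its axioms are TRIO + `sorryAx` through `stub_S2` exactly.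
[cite: Rogawski1990, §15.3 ¶1; Thm. 13.3.6 (c) p. 202] -/
theorem cohClassRoutingCot_closed : CohClassRoutingCotClosed :=
  fun L _ _ _ ι H T hT hH hHd hdef h2 μ _ μω hμu hμω _ _ μZ _ keys =>
    cohClassRoutingCot_holds L H hH hHd μω hμu μZ keys ι T hT μ hdef h2 hμω

end Summit.HodgeConjecture.HodgeConjecture.Cruxes.H413.F0T2CohClassRoutingCotPaydown

end
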